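import Summits.CriticalPhenomena.PercolationContinuityZ3.Theorems.PercNearOneGluingNoHeavyLowerTailSahiPrincipalCutVertex
import Summits.CriticalPhenomena.PercolationContinuityZ3.Theorems.PercNearOneGluingNoHeavyLowerTailSahiPrincipalCycleBlocks
import HarnessLib

/-!
# Worked example: the BOWTIE (two triangles glued at a vertex) — all principal cluster events, every order

Support file for the Sahi programme (`--supports stmt-CriticalPhenomena-4575`, prover prim-sahi-p2 gen 9).
No definitions, no named facts, no sorries; standard axioms.  Memo `…/prim-sahi-p2/PROOF-E3.md` §20.

A demonstration that the cactus kit composes with no further glue: vertices `Fin 5`, triangles `{0,1,2}` and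
`{2,3,4}` sharing the cut vertex `2`, root `0`, ARBITRARY weights on the six triangle edges (the weight is only
required to vanish on loops and on the four pairs joining `{0,1}` to `{3,4}`).  For every `n` and all finite target
sets `T_i ⊆ Fin 5`, `0 ≤ E_n(1_{C_0 ⊇ T_0}, …, 1_{C_0 ⊇ T_{n-1}})`.
Assembly: `SahiPrincipalCutVertex.sahiE_principal_of_cutVertex_univ` with the two blocks supplied by
`IncStarCycle.sahiE_principal_embeddedCycle_block` (embeddings `![0,1,2]`, `![2,3,4]` of the `3`-cycle).
-/

noncomputable section

namespace Summit.CriticalPhenomena.PercolationContinuityZ3.Theorems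

namespace SahiPrincipalCutVertex

open Finset MeasureTheory Literature.Combinatorics.Sahi2008 Literature.Probability.Percolation
  Literature.Probability.LatticeModels
open Literature.Probability.Percolation.DecisionTree (ind ind_of_mem ind_of_not_mem ind_nonneg)
open scoped Classical

/-- **The bowtie**: all principal cluster events of the root `0` of two triangles glued at the vertex `2` are
Sahi-positive at every order, for arbitrary edge weights. [this work] -/
theorem sahiE_principal_bowtie_nonneg (w : Sym2 (Fin 5) → unitInterval)
    (hloop : ∀ x : Fin 5, w s(x, x) = 0)
    (hcross : ∀ x y : Fin 5, x.val ≤ 1 → 3 ≤ y.val → w s(x, y) = 0)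
    (n : ℕ) (T : Fin n → Finset (Fin 5)) :
    0 ≤ sahiE (bernoulliWeight w) n
      (fun i => ind (⋂ t ∈ T i, (openConn (0 : Fin 5) t : Set (BondConfig (Fin 5))))) := by
  -- the two embedded triangles
  let c₁ : Fin 3 → Fin 5 := ![0, 1, 2]
  let c₂ : Fin 3 → Fin 5 := ![2, 3, 4]
  have hc₁ : Function.Injective c₁ := by decide
  have hc₂ : Function.Injective c₂ := by decide
  have hr₁ : ∀ x : Fin 5, x ∈ Set.range c₁ ↔ x.val ≤ 2 := by decide
  have hr₂ : ∀ x : Fin 5, x ∈ Set.range c₂ ↔ 2 ≤ x.val := by decide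
  -- in a triangle every off-diagonal pair is a cycle edge, so only loops must vanish
  have htri : ∀ i j : Fin 3, (∀ k : Fin 3, s(i, j) ≠ s(k, k + 1)) → i = j := by decide
  have hw₁ : ∀ i j : Fin 3, (∀ k : Fin 3, s(i, j) ≠ s(k, k + 1)) → w s(c₁ i, c₁ j) = 0 := by
    intro i j h; rw [htri i j h]; exact hloop _
  have hw₂ : ∀ i j : Fin 3, (∀ k : Fin 3, s(i, j) ≠ s(k, k + 1)) → w s(c₂ i, c₂ j) = 0 := by
    intro i j h; rw [htri i j h]; exact hloop _
  have h3 : 3 ≤ 3 := le_rfl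
  refine sahiE_principal_of_cutVertex_univ w (V₁ := Set.range c₁) (V₂ := Set.range c₂) (a := 2) (s := 0)
    ?_ ?_ ?_ ?_ ?_ ?_ ?_ ?_ T
  · -- V₁ ∩ V₂ ⊆ {2}
    intro x hx₁ hx₂
    rw [hr₁] at hx₁; rw [hr₂] at hx₂
    exact Fin.ext (le_antisymm hx₁ hx₂)
  · exact (hr₁ 2).2 (by decide)
  · exact (hr₂ 2).2 (by decide)
  · exact (hr₁ 0).2 (by decide)
  · intro x; by_cases hx : x.val ≤ 2
    · exact Or.inl ((hr₁ x).2 hx)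
    · exact Or.inr ((hr₂ x).2 (by omega))
  · -- no positive pair across
    intro x y hx hy hxa hya
    rw [hr₁] at hx; rw [hr₂] at hy
    have hx2 : x.val ≠ 2 := fun h => hxa (Fin.ext h)
    have hy2 : y.val ≠ 2 := fun h => hya (Fin.ext h)
    exact hcross x y (by omega) (by omega)
  · -- block 1: the triangle {0,1,2} rooted at 0 = c₁ 0
    intro m T' hT'
    have h := IncStarCycle.sahiE_principal_embeddedCycle_block h3 hc₁ w hw₁ 0 m T' hT'
    simpa [c₁] using h
  · -- block 2: the triangle {2,3,4} rooted at 2 = c₂ 0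
    intro m T' hT'
    have h := IncStarCycle.sahiE_principal_embeddedCycle_block h3 hc₂ w hw₂ 0 m T' hT'
    simpa [c₂] using h

end SahiPrincipalCutVertex

end Summit.CriticalPhenomena.PercolationContinuityZ3.Theorems
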